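import Literature.ModelTheory.ExponentialFields.OMinimalDimensionFrontier
import HarnessLib

/-!
# O-minimal structures eliminate `∃^∞` (van den Dries, Ch. 3, (3.6)–(3.7); Ch. 4, (1.5))

Topic `Literature/ModelTheory/ExponentialFields`.  A consequence of the uniform finiteness of
fibres (L. van den Dries, *Tame topology and o-minimal structures* (1998), Ch. 3, (3.7): "each
finite fiber `S_a` has cardinality at most `M_S`") and of the definability of the sets
`S(d) = {a : dim S_a = d}` (Ch. 4, (1.5), `OMinimalDimensionFibres.lean`): for a definable
`S ⊆ M^{m+n}` **the set of parameters `a ∈ Mᵐ` with finite (resp. infinite) fibre `S_a` is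
definable** — o-minimal structures *eliminate the quantifier `∃^∞`* (a fibre is finite iff it is
empty or of dimension `0`, Ch. 4, (1.1)).

* `definable_setOf_exists_append` — the projection `πS = {a | S_a ≠ ∅}` is definable;
* **`definable_setOf_fibre_finite`**, **`definable_setOf_fibre_infinite`**.

Nothing here is a named fact; no definition is introduced.

## References

* [Dries1998] L. van den Dries, *Tame topology and o-minimal structures*, London Math. Soc.
  Lecture Note Ser. 248, CUP 1998, Ch. 3, (3.7), p. 60; Ch. 4, (1.1), (1.5), pp. 63–66.
-/

open Set FirstOrder FirstOrder.Language

namespace Literature.ModelTheory.ExponentialFields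

open CellDimension

universe u v

variable {L : FirstOrder.Language.{u, v}} {M : Type*} [L.Structure M] [LinearOrder M]
  [TopologicalSpace M] [DenselyOrdered M] [NoMinOrder M] [NoMaxOrder M] [Nonempty M]
  [OrderTopology M]

/-- **The projection `πS = {a ∈ Mᵐ | ∃ y, (a, y) ∈ S}` of a definable `S ⊆ M^{m+n}` is definable**
(here as the union of the sets `S(d)`, `d ≤ n`, of Ch. 4, (1.5)). [cite: Dries1998, Ch. 4 (1.5)] -/
theorem definable_setOf_exists_append (hO : L.IsOMinimal M)
    (hlt : (univ : Set M).Definable L {v : Fin 2 → M | v 0 < v 1}) {m n : ℕ}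
    {S : Set (Fin (m + n) → M)} (hS : (univ : Set M).Definable L S) :
    (univ : Set M).Definable L {a : Fin m → M | ∃ y : Fin n → M, Fin.append a y ∈ S} := by
  classical
  have heq : {a : Fin m → M | ∃ y : Fin n → M, Fin.append a y ∈ S} =
      ⋃ d ∈ Finset.range (n + 1), {a : Fin m → M | (∃ y : Fin n → M, Fin.append a y ∈ S) ∧
        dim L n {y | Fin.append a y ∈ S} = d} := by
    ext a
    simp only [mem_setOf_eq, mem_iUnion, Finset.mem_range, exists_prop]
    constructor
    · intro h
      exact ⟨dim L n {y | Fin.append a y ∈ S}, Nat.lt_succ_of_le (dim_le _), h, rfl⟩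
    · rintro ⟨d, -, h, -⟩
      exact h
  rw [heq]
  exact Set.definable_biUnion_finset (fun d => definable_fibreDimSet hO hlt hS d) _

/-- **O-minimal structures eliminate `∃^∞`: `{a ∈ Mᵐ | S_a is finite}` is definable** for a
definable `S ⊆ M^{m+n}` (a definable set is finite iff it is empty or of dimension `0`, Ch. 4
(1.1); the sets `{a : S_a ≠ ∅, dim S_a = 0}` are definable, Ch. 4 (1.5)). [cite: Dries1998, Ch. 4 (1.5)] -/
theorem definable_setOf_fibre_finite (hO : L.IsOMinimal M)
    (hlt : (univ : Set M).Definable L {v : Fin 2 → M | v 0 < v 1}) {m n : ℕ}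
    {S : Set (Fin (m + n) → M)} (hS : (univ : Set M).Definable L S) :
    (univ : Set M).Definable L {a : Fin m → M | {y : Fin n → M | Fin.append a y ∈ S}.Finite} := by
  have heq : {a : Fin m → M | {y : Fin n → M | Fin.append a y ∈ S}.Finite} =
      {a : Fin m → M | ∃ y : Fin n → M, Fin.append a y ∈ S}ᶜ ∪
        {a : Fin m → M | (∃ y : Fin n → M, Fin.append a y ∈ S) ∧
          dim L n {y | Fin.append a y ∈ S} = 0} := by
    ext a
    simp only [mem_setOf_eq, mem_union, mem_compl_iff, not_exists]
    constructor
    · intro hfin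
      by_cases h : ∃ y : Fin n → M, Fin.append a y ∈ S
      · exact Or.inr ⟨h, dim_eq_zero_of_finite hfin⟩
      · exact Or.inl (not_exists.1 h)
    · rintro (h | ⟨-, h0⟩)
      · have he : {y : Fin n → M | Fin.append a y ∈ S} = ∅ :=
          Set.eq_empty_of_forall_notMem fun y hy => h y hy
        rw [he]
        exact Set.finite_empty
      · exact finite_of_dim_eq_zero hO hlt ((hS.preimage_map (definableMap_append_right a))) h0
  rw [heq]
  exact (definable_setOf_exists_append hO hlt hS).compl.union (definable_fibreDimSet hO hlt hS 0)

/-- **`{a ∈ Mᵐ | S_a is infinite}` is definable** for a definable `S ⊆ M^{m+n}`.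
[cite: Dries1998, Ch. 4 (1.5)] -/
theorem definable_setOf_fibre_infinite (hO : L.IsOMinimal M)
    (hlt : (univ : Set M).Definable L {v : Fin 2 → M | v 0 < v 1}) {m n : ℕ}
    {S : Set (Fin (m + n) → M)} (hS : (univ : Set M).Definable L S) :
    (univ : Set M).Definable L
      {a : Fin m → M | {y : Fin n → M | Fin.append a y ∈ S}.Infinite} := by
  have heq : {a : Fin m → M | {y : Fin n → M | Fin.append a y ∈ S}.Infinite} =
      {a : Fin m → M | {y : Fin n → M | Fin.append a y ∈ S}.Finite}ᶜ := by
    ext a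
    exact Iff.rfl
  rw [heq]
  exact (definable_setOf_fibre_finite hO hlt hS).compl

end Literature.ModelTheory.ExponentialFields
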